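import Mathlib.Analysis.SpecialFunctions.PolarCoord
import Mathlib.MeasureTheory.Constructions.Pi
import Mathlib.MeasureTheory.Function.Jacobian
import Mathlib.MeasureTheory.Measure.Haar.NormedSpace

/-!
# Lovas–Andai 2017 — the `X`-block of the maximally mixed fibre in eigenvalue coordinates

A. Lovas, A. Andai, J. Phys. A 50 (2017) 295303 [LovasAndai2017] (arXiv:1610.01410), proof of
Theorem 2, first display: after Theorem 1 / Corollary 2 the fibre volumes are integrals over the
`2 × 2` block `X = [[x₀, x₂], [x₂, x₁]]`, `0 ≺ X ≺ ½·1`, of `det X · det(½ − X)` times a function of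
the singular-value ratio, i.e. of the ordered spectrum `μ₁ = s̄ + r ≥ μ₂ = s̄ − r` of `X`
(`s̄ = (x₀+x₁)/2`, `r = √(((x₀−x₁)/2)² + x₂²)`); "using the fact that `μ_{d+2}` and `σ(…)` are
invariant under orthogonal transformations" the authors pass to the eigenvalue integral over
`−1 < y < x < 1` (`x, y = 4μ − 1`) with the weight `(1−x²)(1−y²)(x−y)`.

This file proves that passage as a change of variables on `ℝ³` (`lintegral_specIntegrand_eq`):
for every measurable `G : ℝ × ℝ → [0, ∞]`,

  `∫_{ℝ³} 𝟙[0 < s̄−r, s̄+r < ½] (x₀x₁ − x₂²)((½−x₀)(½−x₁) − x₂²) G(s̄+r, s̄−r) dx`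
  `= π · ∫∫_{0<μ₂<μ₁<½} G(μ) μ₁μ₂(½−μ₁)(½−μ₂)(μ₁−μ₂) dμ`,

by: regrouping `ℝ³ ≃ (ℝ × ℝ) × ℝ` (`regroup3`, measure preserving), the sum/difference coordinates
`(x₀, x₁) = (m + p, m − p)` (linear, `|det| = 2`), `Real`'s `polarCoord` on `(p, q) = (p, x₂)`
(`lintegral_comp_polarCoord_symm`; the integrand is radial, `∫ dθ = 2π`), and finally
`(μ₁, μ₂) = (m + r, m − r)` (`|det| = 2`) onto the triangle. The integrand shape `specIntegrand` is
literally the one produced by `TwoQubitSeparabilityVolumesRebitFibreIntegral.lean`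
(`volume_posDef_rebitFibre_eq_lintegral`, `volume_posDef_and_rebitFibre_eq_lintegral`), and the
right-hand side is the eigenvalue-triangle integral of `LovasAndaiTheorem2Integral.lean`.

## References

* [LovasAndai2017] A. Lovas, A. Andai, J. Phys. A 50 (2017) 295303, §3, Corollary 2 and the proof
  of Theorem 2 (first display). arXiv:1610.01410.
-/

noncomputable section

open MeasureTheory Set Filter Topology Real

namespace Literature.Probability.RandomMatrix.LovasAndai2017

/-! ### Regrouping `ℝ³ ≃ (ℝ × ℝ) × ℝ` -/

/-- `x ↦ ((x 0, x 1), x 2)`. [folklore] -/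
def regroup3 : (Fin 3 → ℝ) ≃ᵐ (ℝ × ℝ) × ℝ :=
  ((MeasurableEquiv.piFinSuccAbove (fun _ : Fin 3 => ℝ) 2).trans MeasurableEquiv.prodComm).trans
    (MeasurableEquiv.prodCongr (MeasurableEquiv.finTwoArrow (α := ℝ)) (MeasurableEquiv.refl ℝ))

/-- `regroup3 x = ((x 0, x 1), x 2)`. [folklore] -/
theorem regroup3_apply (x : Fin 3 → ℝ) : regroup3 x = ((x 0, x 1), x 2) := by
  simp [regroup3, MeasurableEquiv.piFinSuccAbove_apply, MeasurableEquiv.finTwoArrow,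
    MeasurableEquiv.prodComm, MeasurableEquiv.prodCongr, MeasurableEquiv.trans_apply,
    Fin.removeNth]
  rfl

/-- `regroup3.symm ((a, b), q) = ![a, b, q]`. [folklore] -/
theorem regroup3_symm_apply (a b q : ℝ) : regroup3.symm ((a, b), q) = ![a, b, q] := by
  apply regroup3.injective
  rw [MeasurableEquiv.apply_symm_apply, regroup3_apply]
  simp

/-- `regroup3` preserves Lebesgue measure. [folklore] -/
theorem measurePreserving_regroup3 : MeasurePreserving regroup3 volume volume := by
  unfold regroup3
  refine MeasurePreserving.trans (μb := volume) ?_ ?_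
  · refine MeasurePreserving.trans (μb := volume) ?_ ?_
    · exact volume_preserving_piFinSuccAbove (fun _ : Fin 3 => ℝ) 2
    · have h := (Measure.measurePreserving_swap (μ := (volume : Measure ℝ))
        (ν := (volume : Measure (Fin 2 → ℝ))))
      rw [← Measure.volume_eq_prod, ← Measure.volume_eq_prod] at h
      exact h
  · have h := (volume_preserving_finTwoArrow ℝ).prod (MeasurePreserving.id (volume : Measure ℝ))
    rw [← Measure.volume_eq_prod, ← Measure.volume_eq_prod] at h
    exact h

/-! ### The linear map `(m, p) ↦ (m + p, m − p)` -/

/-- `L(m, p) = (m + p, m − p)` (sum/difference coordinates; determinant `−2`). [folklore] -/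
def Lmp : ℝ × ℝ →L[ℝ] ℝ × ℝ :=
  (Matrix.toLin (.finTwoProd ℝ) (.finTwoProd ℝ) !![(1:ℝ), 1; 1, -1]).toContinuousLinearMap

/-- `L(m,p) = (m+p, m−p)`. [folklore] -/
theorem Lmp_apply (z : ℝ × ℝ) : Lmp z = (z.1 + z.2, z.1 - z.2) := by
  simp only [Lmp, LinearMap.coe_toContinuousLinearMap', Matrix.toLin_finTwoProd_apply]
  ext <;> simp; ring

/-- `det L = −2`. [folklore] -/
theorem det_Lmp : Lmp.det = -2 := by
  simp only [Lmp, LinearMap.det_toContinuousLinearMap, LinearMap.det_toLin, Matrix.det_fin_two_of]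
  norm_num

/-- `L` is injective. [folklore] -/
theorem Lmp_injective : Function.Injective Lmp := by
  intro z w h
  rw [Lmp_apply, Lmp_apply, Prod.mk.injEq] at h
  obtain ⟨h1, h2⟩ := h
  ext <;> linarith

/-- `L` is onto. [folklore] -/
theorem image_Lmp_univ : Lmp '' univ = univ := by
  ext w
  simp only [image_univ, mem_range, mem_univ, iff_true]
  refine ⟨((w.1 + w.2) / 2, (w.1 - w.2) / 2), ?_⟩
  rw [Lmp_apply]; ext <;> simp <;> ring

/-- **Change of variables by `L` on a set**: `∫_{L(S)} g = ∫_S 2 g∘L`. [folklore] -/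
theorem lintegral_image_Lmp {S : Set (ℝ × ℝ)} (hS : MeasurableSet S) (g : ℝ × ℝ → ENNReal) :
    ∫⁻ x in Lmp '' S, g x = ∫⁻ z in S, 2 * g (Lmp z) := by
  rw [lintegral_image_eq_lintegral_abs_det_fderiv_mul volume hS
    (fun z _ => (Lmp.hasFDerivAt).hasFDerivWithinAt) Lmp_injective.injOn]
  refine setLIntegral_congr_fun hS fun z _ => ?_
  rw [det_Lmp]
  norm_num

/-- `∫ g = ∫ 2 g∘L`. [folklore] -/
theorem lintegral_comp_Lmp (g : ℝ × ℝ → ENNReal) : ∫⁻ x, g x = ∫⁻ z, 2 * g (Lmp z) := by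
  have h := lintegral_image_Lmp MeasurableSet.univ g
  rw [image_Lmp_univ, Measure.restrict_univ] at h
  exact h

/-- `Λ = L × id` on `(ℝ × ℝ) × ℝ`. [folklore] -/
def Lam : (ℝ × ℝ) × ℝ →L[ℝ] (ℝ × ℝ) × ℝ := Lmp.prodMap (ContinuousLinearMap.id ℝ ℝ)

/-- `Λ((m,p),q) = ((m+p, m−p), q)`. [folklore] -/
theorem Lam_apply (y : (ℝ × ℝ) × ℝ) : Lam y = ((y.1.1 + y.1.2, y.1.1 - y.1.2), y.2) := by
  obtain ⟨⟨m, p⟩, q⟩ := y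
  simp [Lam, Lmp_apply]

/-- `det Λ = −2`. [folklore] -/
theorem det_Lam : Lam.det = -2 := by
  have h : (Lam : (ℝ × ℝ) × ℝ →ₗ[ℝ] (ℝ × ℝ) × ℝ) =
      (Lmp : ℝ × ℝ →ₗ[ℝ] ℝ × ℝ).prodMap LinearMap.id := by
    simp [Lam]
  rw [ContinuousLinearMap.det, h, LinearMap.det_prodMap, LinearMap.det_id, mul_one]
  exact det_Lmp

/-- `Λ` is injective. [folklore] -/
theorem Lam_injective : Function.Injective Lam := by
  intro z w h
  rw [Lam_apply, Lam_apply, Prod.mk.injEq, Prod.mk.injEq] at h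
  obtain ⟨⟨h1, h2⟩, h3⟩ := h
  ext <;> linarith

/-- `Λ` is onto. [folklore] -/
theorem image_Lam_univ : Lam '' univ = univ := by
  ext w
  simp only [image_univ, mem_range, mem_univ, iff_true]
  refine ⟨(((w.1.1 + w.1.2) / 2, (w.1.1 - w.1.2) / 2), w.2), ?_⟩
  rw [Lam_apply]; ext <;> simp <;> ring

/-- `∫ g = ∫ 2 g∘Λ` on `(ℝ × ℝ) × ℝ`. [folklore] -/
theorem lintegral_comp_Lam (g : (ℝ × ℝ) × ℝ → ENNReal) : ∫⁻ x, g x = ∫⁻ z, 2 * g (Lam z) := by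
  haveI : (volume : Measure ((ℝ × ℝ) × ℝ)).IsAddHaarMeasure := by
    rw [Measure.volume_eq_prod]; infer_instance
  have h : ∫⁻ x in Lam '' univ, g x = ∫⁻ z in univ, 2 * g (Lam z) := by
    rw [lintegral_image_eq_lintegral_abs_det_fderiv_mul volume MeasurableSet.univ
      (fun z _ => (Lam.hasFDerivAt).hasFDerivWithinAt) Lam_injective.injOn]
    refine setLIntegral_congr_fun MeasurableSet.univ fun z _ => ?_
    rw [det_Lam]
    norm_num
  rw [image_Lam_univ, Measure.restrict_univ] at h
  exact h

/-! ### Radial functions in the plane -/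

/-- **Polar coordinates for radial functions**: `∫_{ℝ²} Φ(√(p²+q²)) = ∫₀^∞ 2πr Φ(r) dr`.
[folklore] -/
theorem lintegral_radial (Φ : ℝ → ENNReal) (hΦ : Measurable Φ) :
    ∫⁻ pq : ℝ × ℝ, Φ (Real.sqrt (pq.1 ^ 2 + pq.2 ^ 2)) =
      ∫⁻ r in Ioi 0, ENNReal.ofReal (2 * π * r) * Φ r := by
  rw [← lintegral_comp_polarCoord_symm]
  have htarget : polarCoord.target = Ioi (0 : ℝ) ×ˢ Ioo (-π) π := rfl
  rw [htarget]
  have hmeas : Measurable fun p : ℝ × ℝ =>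
      ENNReal.ofReal p.1 • Φ (Real.sqrt ((polarCoord.symm p).1 ^ 2 + (polarCoord.symm p).2 ^ 2)) := by
    apply Measurable.smul (ENNReal.measurable_ofReal.comp measurable_fst)
    exact hΦ.comp (by simp only [polarCoord_symm_apply]; fun_prop)
  rw [Measure.volume_eq_prod, setLIntegral_prod _ hmeas.aemeasurable]
  refine setLIntegral_congr_fun measurableSet_Ioi fun r hr => ?_
  have hr' : 0 < r := hr
  have hsq : ∀ θ : ℝ, Real.sqrt ((r * Real.cos θ) ^ 2 + (r * Real.sin θ) ^ 2) = r := by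
    intro θ
    have : (r * Real.cos θ) ^ 2 + (r * Real.sin θ) ^ 2 = r ^ 2 := by
      have := Real.cos_sq_add_sin_sq θ
      nlinarith
    rw [this, Real.sqrt_sq hr'.le]
  simp only [polarCoord_symm_apply, hsq, smul_eq_mul]
  rw [setLIntegral_const, Real.volume_Ioo,
    show π - -π = 2 * π by ring, mul_comm (ENNReal.ofReal r * Φ r), ← mul_assoc]
  congr 1
  rw [← ENNReal.ofReal_mul (by positivity)]

/-! ### The main change of variables -/

/-- `s̄(x) = (x₀ + x₁)/2` (mean eigenvalue of `X = [[x₀, x₂], [x₂, x₁]]`). [folklore] -/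
def xsbar (x : Fin 3 → ℝ) : ℝ := (x 0 + x 1) / 2

/-- `r(x) = √(((x₀ − x₁)/2)² + x₂²)` (half the eigenvalue gap of `X`). [folklore] -/
def xrad (x : Fin 3 → ℝ) : ℝ := Real.sqrt (((x 0 - x 1) / 2) ^ 2 + x 2 ^ 2)

/-- The spectral integrand: `𝟙[0 < s̄−r, s̄+r < ½] · det X det(½−X) · G(s̄+r, s̄−r)`. [folklore] -/
def specIntegrand (G : ℝ × ℝ → ENNReal) (x : Fin 3 → ℝ) : ENNReal :=
  if 0 < xsbar x - xrad x ∧ xsbar x + xrad x < 1 / 2 then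
    ENNReal.ofReal ((x 0 * x 1 - x 2 ^ 2) * ((1 / 2 - x 0) * (1 / 2 - x 1) - x 2 ^ 2)) *
      G (xsbar x + xrad x, xsbar x - xrad x)
  else 0

/-- The reduced integrand in the mean/gap variables `(m, r)`. [folklore] -/
def mrIntegrand (G : ℝ × ℝ → ENNReal) (m r : ℝ) : ENNReal :=
  if 0 < m - r ∧ m + r < 1 / 2 then
    ENNReal.ofReal ((m ^ 2 - r ^ 2) * ((1 / 2 - m) ^ 2 - r ^ 2)) * G (m + r, m - r)
  else 0

/-- Measurability of `mrIntegrand` in `(m, r)`. [folklore] -/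
theorem measurable_mrIntegrand {G : ℝ × ℝ → ENNReal} (hG : Measurable G) :
    Measurable fun z : ℝ × ℝ => mrIntegrand G z.1 z.2 := by
  unfold mrIntegrand
  refine Measurable.ite ?_ ?_ measurable_const
  · exact (measurableSet_lt measurable_const (measurable_fst.sub measurable_snd)).inter
      (measurableSet_lt (measurable_fst.add measurable_snd) measurable_const)
  · exact (ENNReal.measurable_ofReal.comp (by fun_prop)).mul (hG.comp (by fun_prop))

/-- The spectral integrand in the coordinates `x = (m+p, m−p, q)`: `r = √(p²+q²)`. [folklore] -/
theorem specIntegrand_cons (G : ℝ × ℝ → ENNReal) (m p q : ℝ) :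
    specIntegrand G ![m + p, m - p, q] = mrIntegrand G m (Real.sqrt (p ^ 2 + q ^ 2)) := by
  have hs : xsbar ![m + p, m - p, q] = m := by
    simp only [xsbar, Matrix.cons_val_zero, Matrix.cons_val_one]
    ring
  have hr : xrad ![m + p, m - p, q] = Real.sqrt (p ^ 2 + q ^ 2) := by
    unfold xrad
    have e : ((((![m + p, m - p, q] : Fin 3 → ℝ) 0 - (![m + p, m - p, q] : Fin 3 → ℝ) 1) / 2) ^ 2 +
        (![m + p, m - p, q] : Fin 3 → ℝ) 2 ^ 2) = p ^ 2 + q ^ 2 := by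
      simp only [Matrix.cons_val_zero, Matrix.cons_val_one, Matrix.cons_val_two, Matrix.head_cons,
        Matrix.tail_cons]
      ring
    rw [e]
  have hsq : Real.sqrt (p ^ 2 + q ^ 2) ^ 2 = p ^ 2 + q ^ 2 := Real.sq_sqrt (by positivity)
  simp only [specIntegrand, mrIntegrand, hs, hr]
  have e1 : ((![m + p, m - p, q] : Fin 3 → ℝ) 0 * (![m + p, m - p, q] : Fin 3 → ℝ) 1 -
      (![m + p, m - p, q] : Fin 3 → ℝ) 2 ^ 2) *
      ((1 / 2 - (![m + p, m - p, q] : Fin 3 → ℝ) 0) * (1 / 2 - (![m + p, m - p, q] : Fin 3 → ℝ) 1) -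
        (![m + p, m - p, q] : Fin 3 → ℝ) 2 ^ 2) =
      (m ^ 2 - Real.sqrt (p ^ 2 + q ^ 2) ^ 2) * ((1 / 2 - m) ^ 2 - Real.sqrt (p ^ 2 + q ^ 2) ^ 2) := by
    rw [hsq]
    simp only [Matrix.cons_val_zero, Matrix.cons_val_one, Matrix.cons_val_two, Matrix.head_cons,
      Matrix.tail_cons]
    ring
  rw [e1]

/-- **The `X`-block in eigenvalue coordinates.** For a measurable `G ≥ 0` on ordered eigenvalue
pairs `(μ₁, μ₂)`, `μ₁ ≥ μ₂`,
`∫_{ℝ³} 𝟙[0 ≺ X ≺ ½] det X det(½−X) G(μ₁, μ₂) dx = π ∫∫_{0<μ₂<μ₁<½} G(μ) μ₁μ₂(½−μ₁)(½−μ₂)(μ₁−μ₂) dμ`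
(`x = (s̄ + r cos θ, s̄ − r cos θ, r sin θ)`, `dx = 2 r ds̄ dr dθ`, `μ = s̄ ± r`). This is the passage
"by the invariance of `μ_{d+2}` and `σ` under orthogonal transformations" from Corollary 2 to the
`(x, y)` integral in the proof of Theorem 2 of [LovasAndai2017] (their `x, y ∈ (−1, 1)` are `4μ − 1`).
[cite: LovasAndai2017, Theorem 2 (proof, first display)] -/
theorem lintegral_specIntegrand_eq (G : ℝ × ℝ → ENNReal) (hG : Measurable G) :
    ∫⁻ x : Fin 3 → ℝ, specIntegrand G x =
      ENNReal.ofReal π * ∫⁻ μ in {μ : ℝ × ℝ | 0 < μ.2 ∧ μ.2 < μ.1 ∧ μ.1 < 1 / 2},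
        G μ * ENNReal.ofReal (μ.1 * μ.2 * (1 / 2 - μ.1) * (1 / 2 - μ.2) * (μ.1 - μ.2)) := by
  have hK := measurable_mrIntegrand hG
  -- (1) regroup and (2) sum/difference coordinates
  have h1 : ∫⁻ x : Fin 3 → ℝ, specIntegrand G x =
      ∫⁻ y : (ℝ × ℝ) × ℝ, specIntegrand G (regroup3.symm y) :=
    ((measurePreserving_regroup3.symm regroup3).lintegral_comp_emb
      regroup3.symm.measurableEmbedding _).symm
  have h2 : ∫⁻ y : (ℝ × ℝ) × ℝ, specIntegrand G (regroup3.symm y) =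
      ∫⁻ y : (ℝ × ℝ) × ℝ, 2 * mrIntegrand G y.1.1 (Real.sqrt (y.1.2 ^ 2 + y.2 ^ 2)) := by
    rw [lintegral_comp_Lam]
    refine lintegral_congr fun y => ?_
    obtain ⟨⟨m, p⟩, q⟩ := y
    rw [Lam_apply]
    dsimp only
    rw [regroup3_symm_apply, specIntegrand_cons]
  -- (3) reassociate and (4) Tonelli, (5) polar coordinates in `(p, q)`
  have h3 : ∫⁻ y : (ℝ × ℝ) × ℝ, 2 * mrIntegrand G y.1.1 (Real.sqrt (y.1.2 ^ 2 + y.2 ^ 2)) =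
      ∫⁻ w : ℝ × (ℝ × ℝ), 2 * mrIntegrand G w.1 (Real.sqrt (w.2.1 ^ 2 + w.2.2 ^ 2)) :=
    ((volume_preserving_prodAssoc (α₁ := ℝ) (β₁ := ℝ) (γ₁ := ℝ)).lintegral_comp_emb
      (MeasurableEquiv.prodAssoc).measurableEmbedding
      (fun w : ℝ × (ℝ × ℝ) => 2 * mrIntegrand G w.1 (Real.sqrt (w.2.1 ^ 2 + w.2.2 ^ 2))))
  have hH : Measurable fun w : ℝ × (ℝ × ℝ) => 2 * mrIntegrand G w.1 (Real.sqrt (w.2.1 ^ 2 + w.2.2 ^ 2)) :=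
    (hK.comp (measurable_fst.prodMk (by fun_prop))).const_mul _
  have h4 : ∫⁻ w : ℝ × (ℝ × ℝ), 2 * mrIntegrand G w.1 (Real.sqrt (w.2.1 ^ 2 + w.2.2 ^ 2)) =
      ∫⁻ m : ℝ, ∫⁻ r in Ioi 0, ENNReal.ofReal (2 * π * r) * (2 * mrIntegrand G m r) := by
    rw [Measure.volume_eq_prod, lintegral_prod _ hH.aemeasurable]
    refine lintegral_congr fun m => ?_
    exact lintegral_radial (fun r => 2 * mrIntegrand G m r) ((hK.comp (measurable_const.prodMk measurable_id)).const_mul _)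
  -- (6) back to a product-set integral in `(m, r)`
  have hJ : Measurable fun z : ℝ × ℝ => ENNReal.ofReal (2 * π * z.2) * (2 * mrIntegrand G z.1 z.2) :=
    (ENNReal.measurable_ofReal.comp (by fun_prop)).mul (hK.const_mul _)
  have h6 : ∫⁻ m : ℝ, ∫⁻ r in Ioi 0, ENNReal.ofReal (2 * π * r) * (2 * mrIntegrand G m r) =
      ∫⁻ z in (univ : Set ℝ) ×ˢ Ioi (0:ℝ), ENNReal.ofReal (2 * π * z.2) * (2 * mrIntegrand G z.1 z.2) := by
    rw [Measure.volume_eq_prod, setLIntegral_prod _ hJ.aemeasurable]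
    simp only [Measure.restrict_univ]
  -- (7) the indicator inside `mrIntegrand` restricts to `S₃`
  set S₃ : Set (ℝ × ℝ) := {z | 0 < z.2 ∧ 0 < z.1 - z.2 ∧ z.1 + z.2 < 1 / 2} with hS₃
  have hS₃m : MeasurableSet S₃ := by
    have : S₃ = {z : ℝ × ℝ | 0 < z.2} ∩ {z | 0 < z.1 - z.2} ∩ {z | z.1 + z.2 < 1 / 2} := by
      ext z; simp [hS₃, and_assoc]
    rw [this]
    exact ((measurableSet_lt measurable_const measurable_snd).inter
      (measurableSet_lt measurable_const (measurable_fst.sub measurable_snd))).inter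
      (measurableSet_lt (measurable_fst.add measurable_snd) measurable_const)
  set P : ℝ × ℝ → ℝ := fun z => (z.1 ^ 2 - z.2 ^ 2) * ((1 / 2 - z.1) ^ 2 - z.2 ^ 2) with hP
  have h7 : ∫⁻ z in (univ : Set ℝ) ×ˢ Ioi (0:ℝ), ENNReal.ofReal (2 * π * z.2) * (2 * mrIntegrand G z.1 z.2) =
      ∫⁻ z in S₃, ENNReal.ofReal (2 * π * z.2) * (2 * (ENNReal.ofReal (P z) * G (z.1 + z.2, z.1 - z.2))) := by
    have hind : ∀ z : ℝ × ℝ, ENNReal.ofReal (2 * π * z.2) * (2 * mrIntegrand G z.1 z.2) =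
        Set.indicator {z : ℝ × ℝ | 0 < z.1 - z.2 ∧ z.1 + z.2 < 1 / 2}
          (fun z => ENNReal.ofReal (2 * π * z.2) * (2 * (ENNReal.ofReal (P z) * G (z.1 + z.2, z.1 - z.2)))) z := by
      intro z
      simp only [mrIntegrand, Set.indicator, mem_setOf_eq, hP]
      split_ifs <;> simp
    have hB : MeasurableSet {z : ℝ × ℝ | 0 < z.1 - z.2 ∧ z.1 + z.2 < 1 / 2} :=
      (measurableSet_lt measurable_const (measurable_fst.sub measurable_snd)).inter
        (measurableSet_lt (measurable_fst.add measurable_snd) measurable_const)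
    simp_rw [hind]
    rw [lintegral_indicator hB, Measure.restrict_restrict hB]
    congr 1
    congr 1
    ext z
    simp only [hS₃, mem_inter_iff, mem_setOf_eq, mem_prod, mem_univ, mem_Ioi, true_and]
    tauto
  -- (8) the triangle is `L(S₃)`
  have himg : Lmp '' S₃ = {μ : ℝ × ℝ | 0 < μ.2 ∧ μ.2 < μ.1 ∧ μ.1 < 1 / 2} := by
    ext ⟨a, b⟩
    simp only [mem_image, mem_setOf_eq, hS₃, Lmp_apply, Prod.mk.injEq]
    constructor
    · rintro ⟨⟨m, r⟩, ⟨hr, hb, ha⟩, h1, h2⟩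
      dsimp only at hr hb ha h1 h2
      refine ⟨by linarith, by linarith, by linarith⟩
    · rintro ⟨hb, hab, ha⟩
      exact ⟨((a + b) / 2, (a - b) / 2), ⟨by dsimp only; linarith, by dsimp only; linarith,
        by dsimp only; linarith⟩, by ring, by ring⟩
  have h8 : ∫⁻ μ in {μ : ℝ × ℝ | 0 < μ.2 ∧ μ.2 < μ.1 ∧ μ.1 < 1 / 2},
      G μ * ENNReal.ofReal (μ.1 * μ.2 * (1 / 2 - μ.1) * (1 / 2 - μ.2) * (μ.1 - μ.2)) =
      ∫⁻ z in S₃, 2 * (G (z.1 + z.2, z.1 - z.2) * ENNReal.ofReal (2 * z.2 * P z)) := by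
    rw [← himg, lintegral_image_Lmp hS₃m]
    refine setLIntegral_congr_fun hS₃m fun z _ => ?_
    rw [Lmp_apply]
    dsimp only
    congr 3
    simp only [hP]; ring
  rw [h1, h2, h3, h4, h6, h7, h8, ← lintegral_const_mul _ (by
    exact ((hG.comp (by fun_prop)).mul (ENNReal.measurable_ofReal.comp (by fun_prop))).const_mul _)]
  refine setLIntegral_congr_fun hS₃m fun z hz => ?_
  obtain ⟨hr, hb, ha⟩ := hz
  have hPz : 0 ≤ P z := by
    simp only [hP]
    have e : (z.1 ^ 2 - z.2 ^ 2) * ((1 / 2 - z.1) ^ 2 - z.2 ^ 2) =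
        ((z.1 + z.2) * (z.1 - z.2)) * ((1 / 2 - (z.1 + z.2)) * (1 / 2 - (z.1 - z.2))) := by ring
    rw [e]
    apply mul_nonneg <;> apply mul_nonneg <;> linarith
  -- both sides are `ofReal (4 π r P) * G`
  have lhs : ENNReal.ofReal (2 * π * z.2) * (2 * (ENNReal.ofReal (P z) * G (z.1 + z.2, z.1 - z.2))) =
      ENNReal.ofReal (4 * π * z.2 * P z) * G (z.1 + z.2, z.1 - z.2) := by
    rw [show (2 : ENNReal) = ENNReal.ofReal 2 by simp, ← mul_assoc, ← mul_assoc,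
      ← ENNReal.ofReal_mul (by positivity), ← ENNReal.ofReal_mul (by positivity)]
    congr 2; ring
  have rhs : ENNReal.ofReal π * (2 * (G (z.1 + z.2, z.1 - z.2) * ENNReal.ofReal (2 * z.2 * P z))) =
      ENNReal.ofReal (4 * π * z.2 * P z) * G (z.1 + z.2, z.1 - z.2) := by
    rw [show (2 : ENNReal) = ENNReal.ofReal 2 by simp, ← mul_assoc,
      ← ENNReal.ofReal_mul (by positivity), mul_comm (G _), ← mul_assoc,
      ← ENNReal.ofReal_mul (by positivity)]
    congr 2; ring
  rw [lhs, rhs]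

end Literature.Probability.RandomMatrix.LovasAndai2017

end
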